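import Summits.BirchSwinnertonDyer.BirchSwinnertonDyer.Theorems.ByReductionTypeAtTwoTorsionEulerCharB6Principal
import Summits.BirchSwinnertonDyer.BirchSwinnertonDyer.Theorems.ByReductionTypeAtTwoTorsionEulerCharB6LayerKummer
import Summits.BirchSwinnertonDyer.BirchSwinnertonDyer.Theorems.ByReductionTypeAtTwoTorsionEulerCharB6SelmerStable
import Summits.BirchSwinnertonDyer.BirchSwinnertonDyer.Theorems.ByReductionTypeAtTwoTorsionEulerCharB6UniformExponents
import Summits.BirchSwinnertonDyer.BirchSwinnertonDyer.Theorems.ByReductionTypeAtTwoTorsionEulerCharH46LevelZeroInputs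
import Summits.BirchSwinnertonDyer.BirchSwinnertonDyer.Theorems.ByReductionTypeAtTwoGoodOrdTowerControlAllP
import Literature.NumberTheory.GaloisRepresentations.ContinuousCorestrictionTransitive
import Literature.NumberTheory.GaloisRepresentations.ConjugationDescent
import Literature.NumberTheory.EllipticCurves.IwasawaSelmerControlLocalizationProofs
import Literature.NumberTheory.EllipticCurves.IwasawaSelmerProofs
import HarnessLib

set_option linter.dupNamespace false -- `…BirchSwinnertonDyer.BirchSwinnertonDyer…` is the cell's nested layout (D-0017)
set_option autoImplicit false

/-!
# H46 kernel programme (road C′), brick B6 — INPUTS of the finite-coefficient schedule: dialect bridges (`push` / `cohomologyMap` /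
# `cor`), the uniform kill `p^{e₂} · cor_{Γ_n→Γ_ℚ} (Sel(E/ℚ_n)) = 0`, and «`cor` of principal classes of deep layers vanishes»

Cell `bsd-2adic` (run/shared/lean/pub/bsd-2adic/), seat `bsd-2adic-tower-1` GEN 38; `--supports stmt-BirchSwinnertonDyer-19271`
(helper, item `OrdKatoHalfAtTwo`, TOWER road). THEOREMS ONLY (no definition, no named fact, no instance, no `sorry`); closes no
item; nothing booked; BSD is not proved by any of this. Schedule of record: `HOME/tower/gen38/NOTE-B6-SCHEDULE-GEN38.md`.

* §1 bridges between the `push` dialect (brick K: `resH1Hom` along `E[p^L] ≤ E[p^∞]` on `torsionH1Over`) and the `cohomologyMap` /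
  `resLe` / `coresLe` dialect of the corestriction files (`push_eq_cohomologyMap`, `push_cohomologyMap_incl`, `push_resLe`,
  `push_coresLe`, `push_nsmul`, `push_sub`, `coresLe_resLe_eq_nsmul`, `push_sub_eq_zero_of_pushes`,
  `pow_nsmul_eq_zero_of_cohomologyMap_primary_eq_zero`, `resH1Hom_subgroupIncl_eq_resSubgroup`, `conjMap_primary_eq_conjH1`,
  `resOfLe_resH1Hom_subgroupIncl`, `cohomologyMap_resLe`, `restrictHomOfLe_subgroupRepHom`) — all stated with the CANONICAL instances
  so that they rewrite syntactically inside long proofs;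
* §2 `exists_pow_nsmul_cores_eq_zero_of_mem_selmerLayer` (`K = ℚ`, good ordinary `p`, `κ` cyclotomic, `Sel_{p^∞}(E/ℚ)` finite): ONE
  `p^{e₂}` kills `cor_{Γ_n→Γ_ℚ} Y` for every Selmer class `Y` of every layer (its restriction to `ℚ_∞` is a norm inside the finite
  `Sel_∞^Γ`); `exists_forall_cores_eq_zero_of_forall_eq_sub_pow`: `cor_{Γ_m→Γ_ℚ}` kills principal classes of `H¹(Γ_m, E[p^L])`, `m ≫ 0`.
[cite: GreenbergLNM1716, Thm. 1.2, §3 Lemma 3.1 (p. 86), §4 Lemma 4.6 (pp. 105–108)] [cite: SerreGaloisCohomology1997, I §2.4, §5.1]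
-/

noncomputable section

open scoped Classical NumberField ContRepresentation

namespace Summit.BirchSwinnertonDyer.BirchSwinnertonDyer.Theorems

namespace TorsionEulerChar.B6

open CategoryTheory Field NumberField IsDedekindDomain WeierstrassCurve
  Literature.NumberTheory.EllipticCurves Literature.NumberTheory.EllipticCurves.CyclotomicLayer
  Literature.NumberTheory.EllipticCurves.GreenbergSelmer
  Literature.NumberTheory.GaloisRepresentations Literature.NumberTheory.GaloisRepresentations.DiscreteGaloisModule
  Literature.NumberTheory.GaloisCohomology ZpExtension
open _root_.TopRep _root_.ContinuousCohomology
open Literature.Algebra.Homology.DiscreteRep (toTopRepHom)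

/-! ## §1 Bridges between the `push` dialect (`resH1Hom` along `E[p^L] ≤ E[p^∞]`) and the `cohomologyMap` dialect -/

section Bridges

variable {K : Type} [Field K] (W : WeierstrassCurve K) [W.IsElliptic] (p : ℕ) [hp : Fact p.Prime]

omit [W.IsElliptic] hp in
/-- The inclusion `E[p^L] ↪ E[p^∞]` as a morphism of topological representations of `Γ_K` (existence, with its action on points).
[folklore] -/
theorem exists_hom_torsion_primary (L : ℕ) :
    ∃ ι : (W.torsionGaloisModule ((p : ℤ) ^ L)).toTopRep ⟶ discreteTopRep (absoluteGaloisGroup K) (W.geomPrimaryTorsion p),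
      ∀ P : W.geomTorsion ((p : ℤ) ^ L), ((ι.hom P : W.geomPrimaryTorsion p) : W.geomPoints) = (P : W.geomPoints) :=
  ⟨TopRep.ofHom
    { toLinearMap := (AddSubgroup.inclusion (AcSigned.geomTorsion_zpow_le_geomPrimaryTorsion W p L)).toIntLinearMap
      cont := continuous_of_discreteTopology
      isIntertwining' := fun _ ↦ by ext; rfl }, fun _ ↦ rfl⟩

omit [W.IsElliptic] hp in
/-- `E[p^L] ≤ E[p^{L'}]` for `L ≤ L'`. [folklore] -/
theorem geomTorsion_pow_le_geomTorsion_pow {L L' : ℕ} (h : L ≤ L') :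
    W.geomTorsion ((p : ℤ) ^ L) ≤ W.geomTorsion ((p : ℤ) ^ L') := fun P hP ↦ by
  rw [mem_geomTorsion_iff] at hP ⊢
  obtain ⟨d, rfl⟩ := Nat.exists_eq_add_of_le h
  rw [pow_add, mul_comm, mul_smul, hP, smul_zero]

omit [W.IsElliptic] hp in
/-- The inclusion `E[p^L] ↪ E[p^{L'}]` (`L ≤ L'`) as a morphism of topological representations (existence, action on points).
[folklore] -/
theorem exists_hom_torsion_torsion {L L' : ℕ} (h : L ≤ L') :
    ∃ ι : (W.torsionGaloisModule ((p : ℤ) ^ L)).toTopRep ⟶ (W.torsionGaloisModule ((p : ℤ) ^ L')).toTopRep,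
      ∀ P : W.geomTorsion ((p : ℤ) ^ L), ((ι.hom P : W.geomTorsion ((p : ℤ) ^ L')) : W.geomPoints) = (P : W.geomPoints) :=
  ⟨TopRep.ofHom
    { toLinearMap := (AddSubgroup.inclusion (geomTorsion_pow_le_geomTorsion_pow W p h)).toIntLinearMap
      cont := continuous_of_discreteTopology
      isIntertwining' := fun _ ↦ by ext; rfl }, fun _ ↦ rfl⟩

omit [W.IsElliptic] hp in
/-- **`push` in the `cohomologyMap` dialect**: the push `H¹(H, E[p^L]) → H¹(H, E[p^∞])` (brick K, `resH1Hom` along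
`E[p^L] ≤ E[p^∞]`) is `H¹` of the inclusion morphism `ι : E[p^L] ⟶ E[p^∞]` restricted to `H`. [folklore] -/
theorem push_eq_cohomologyMap (H : Subgroup (absoluteGaloisGroup K)) (L : ℕ)
    (ι : (W.torsionGaloisModule ((p : ℤ) ^ L)).toTopRep ⟶ discreteTopRep (absoluteGaloisGroup K) (W.geomPrimaryTorsion p))
    (hι : ∀ P : W.geomTorsion ((p : ℤ) ^ L), ((ι.hom P : W.geomPrimaryTorsion p) : W.geomPoints) = (P : W.geomPoints))
    (x : W.torsionH1Over ((p : ℤ) ^ L) H) :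
    resH1Hom (N := W.geomPrimaryTorsion p) (subgroupInclusion (le_refl H))
        (AddSubgroup.inclusion (AcSigned.geomTorsion_zpow_le_geomPrimaryTorsion W p L)) (fun _ _ ↦ rfl) x =
      cohomologyMap (subgroupRepHom ι H) 1 x := by
  obtain ⟨φ, rfl⟩ := oneCocycleClass_surjective (discreteTopRep H (W.geomTorsion ((p : ℤ) ^ L))) x
  refine (resH1Hom_oneCocycleClass _ _ _ φ).trans (Eq.trans ?_
    (cohomologyMap_oneCocycleClass (A := subgroupRep (W.torsionGaloisModule ((p : ℤ) ^ L)).toTopRep H) _ φ).symm)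
  refine congrArg _ (Subtype.ext (ContinuousMap.ext fun σ ↦ Subtype.ext ?_))
  change _ = ((ι.hom (φ.1 σ) : W.geomPrimaryTorsion p) : W.geomPoints)
  rw [hι]
  rfl

omit [W.IsElliptic] hp in
/-- **`push ∘ ι_* = push`** for the inclusion `ι : E[p^L] ⟶ E[p^{L'}]`. [folklore] -/
theorem push_cohomologyMap_incl (H : Subgroup (absoluteGaloisGroup K)) {L L' : ℕ}
    (ι : (W.torsionGaloisModule ((p : ℤ) ^ L)).toTopRep ⟶ (W.torsionGaloisModule ((p : ℤ) ^ L')).toTopRep)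
    (hι : ∀ P : W.geomTorsion ((p : ℤ) ^ L), ((ι.hom P : W.geomTorsion ((p : ℤ) ^ L')) : W.geomPoints) = (P : W.geomPoints))
    (x : W.torsionH1Over ((p : ℤ) ^ L) H) :
    resH1Hom (N := W.geomPrimaryTorsion p) (subgroupInclusion (le_refl H))
        (AddSubgroup.inclusion (AcSigned.geomTorsion_zpow_le_geomPrimaryTorsion W p L')) (fun _ _ ↦ rfl)
        (cohomologyMap (subgroupRepHom ι H) 1 x) =
      resH1Hom (N := W.geomPrimaryTorsion p) (subgroupInclusion (le_refl H))
        (AddSubgroup.inclusion (AcSigned.geomTorsion_zpow_le_geomPrimaryTorsion W p L)) (fun _ _ ↦ rfl) x := by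
  obtain ⟨φ, rfl⟩ := oneCocycleClass_surjective (discreteTopRep H (W.geomTorsion ((p : ℤ) ^ L))) x
  have h1 := cohomologyMap_oneCocycleClass (A := subgroupRep (W.torsionGaloisModule ((p : ℤ) ^ L)).toTopRep H)
    (subgroupRepHom ι H) φ
  refine (congrArg _ h1).trans ((resH1Hom_oneCocycleClass _ _ _ _).trans
    (Eq.trans ?_ (resH1Hom_oneCocycleClass _ _ _ φ).symm))
  refine congrArg _ (Subtype.ext (ContinuousMap.ext fun σ ↦ Subtype.ext ?_))
  change ((ι.hom (φ.1 (subgroupInclusion (le_refl H) σ)) : W.geomTorsion ((p : ℤ) ^ L')) : W.geomPoints) =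
    ((φ.1 (subgroupInclusion (le_refl H) σ) : W.geomTorsion ((p : ℤ) ^ L)) : W.geomPoints)
  rw [hι]

omit [W.IsElliptic] hp in
/-- **`push ∘ res = res ∘ push`** (restriction to a smaller subgroup). [folklore] -/
theorem push_resLe {H H' : Subgroup (absoluteGaloisGroup K)} (h : H ≤ H') (L : ℕ) (x : W.torsionH1Over ((p : ℤ) ^ L) H') :
    resH1Hom (N := W.geomPrimaryTorsion p) (subgroupInclusion (le_refl H))
        (AddSubgroup.inclusion (AcSigned.geomTorsion_zpow_le_geomPrimaryTorsion W p L)) (fun _ _ ↦ rfl)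
        (resLe (W.torsionGaloisModule ((p : ℤ) ^ L)).toTopRep h 1 x) =
      W.resOfLe p h (resH1Hom (N := W.geomPrimaryTorsion p) (subgroupInclusion (le_refl H'))
        (AddSubgroup.inclusion (AcSigned.geomTorsion_zpow_le_geomPrimaryTorsion W p L)) (fun _ _ ↦ rfl) x) := by
  obtain ⟨φ, rfl⟩ := oneCocycleClass_surjective (discreteTopRep H' (W.geomTorsion ((p : ℤ) ^ L))) x
  have h1 := resLe_oneCocycleClass (W.torsionGaloisModule ((p : ℤ) ^ L)).toTopRep h φ
  refine (congrArg _ h1).trans ((resH1Hom_oneCocycleClass _ _ _ _).trans (Eq.trans ?_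
    ((congrArg _ (resH1Hom_oneCocycleClass _ _ _ φ)).trans (resH1Hom_oneCocycleClass _ _ _ _)).symm))
  exact congrArg _ (Subtype.ext (ContinuousMap.ext fun σ ↦ rfl))

omit [W.IsElliptic] hp in
/-- **`push ∘ cor_{H′/H} = cor_{H′/H} ∘ push`**: the relative corestriction commutes with the push to `E[p^∞]`-coefficients (naturality
of `cor` in the coefficients, `cohomologyMap_coresLe`, read through `push_eq_cohomologyMap`). [cite: SerreGaloisCohomology1997, I §2.4] -/
theorem push_coresLe {H H' : Subgroup (absoluteGaloisGroup K)} (h : H ≤ H') (hH : IsOpen (H : Set (absoluteGaloisGroup K)))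
    [Fintype (H' ⧸ H.subgroupOf H')] (L : ℕ)
    (ι : (W.torsionGaloisModule ((p : ℤ) ^ L)).toTopRep ⟶ discreteTopRep (absoluteGaloisGroup K) (W.geomPrimaryTorsion p))
    (hι : ∀ P : W.geomTorsion ((p : ℤ) ^ L), ((ι.hom P : W.geomPrimaryTorsion p) : W.geomPoints) = (P : W.geomPoints))
    (z : W.torsionH1Over ((p : ℤ) ^ L) H) :
    resH1Hom (N := W.geomPrimaryTorsion p) (subgroupInclusion (le_refl H'))
        (AddSubgroup.inclusion (AcSigned.geomTorsion_zpow_le_geomPrimaryTorsion W p L)) (fun _ _ ↦ rfl)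
        (coresLe (W.torsionGaloisModule ((p : ℤ) ^ L)).toTopRep h hH z) =
      coresLe (discreteTopRep (absoluteGaloisGroup K) (W.geomPrimaryTorsion p)) h hH
        (resH1Hom (N := W.geomPrimaryTorsion p) (subgroupInclusion (le_refl H))
          (AddSubgroup.inclusion (AcSigned.geomTorsion_zpow_le_geomPrimaryTorsion W p L)) (fun _ _ ↦ rfl) z) := by
  rw [push_eq_cohomologyMap W p _ L ι hι, push_eq_cohomologyMap W p _ L ι hι]
  exact cohomologyMap_coresLe h hH (subgroupRepHom ι H') z

omit [W.IsElliptic] hp in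
/-- `push (n • x) = n • push x` (stated with the canonical scalar actions, so that it rewrites syntactically). [folklore] -/
theorem push_nsmul (H : Subgroup (absoluteGaloisGroup K)) (L n : ℕ) (x : W.torsionH1Over ((p : ℤ) ^ L) H) :
    resH1Hom (N := W.geomPrimaryTorsion p) (subgroupInclusion (le_refl H))
        (AddSubgroup.inclusion (AcSigned.geomTorsion_zpow_le_geomPrimaryTorsion W p L)) (fun _ _ ↦ rfl) (n • x) =
      n • resH1Hom (N := W.geomPrimaryTorsion p) (subgroupInclusion (le_refl H))
        (AddSubgroup.inclusion (AcSigned.geomTorsion_zpow_le_geomPrimaryTorsion W p L)) (fun _ _ ↦ rfl) x :=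
  map_nsmul _ _ _

omit [W.IsElliptic] hp in
/-- `push (x - y) = push x - push y` (canonical instances). [folklore] -/
theorem push_sub (H : Subgroup (absoluteGaloisGroup K)) (L : ℕ) (x y : W.torsionH1Over ((p : ℤ) ^ L) H) :
    resH1Hom (N := W.geomPrimaryTorsion p) (subgroupInclusion (le_refl H))
        (AddSubgroup.inclusion (AcSigned.geomTorsion_zpow_le_geomPrimaryTorsion W p L)) (fun _ _ ↦ rfl) (x - y) =
      resH1Hom (N := W.geomPrimaryTorsion p) (subgroupInclusion (le_refl H))
        (AddSubgroup.inclusion (AcSigned.geomTorsion_zpow_le_geomPrimaryTorsion W p L)) (fun _ _ ↦ rfl) x -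
      resH1Hom (N := W.geomPrimaryTorsion p) (subgroupInclusion (le_refl H))
        (AddSubgroup.inclusion (AcSigned.geomTorsion_zpow_le_geomPrimaryTorsion W p L)) (fun _ _ ↦ rfl) y :=
  map_sub _ _ _

omit [W.IsElliptic] hp in
/-- **`cor_{H′/H} (res_{H/H′} y) = [H′ : H] • y`** on `H¹(H′, E[p^L])`, with the index supplied as a number and the canonical `ℕ`-action
(`coresLe_resLe_eq_index_smul` read through `Nat.cast_smul_eq_nsmul`). [cite: SerreGaloisCohomology1997, I §2.4 (Prop. 9)] -/
theorem coresLe_resLe_eq_nsmul {H H' : Subgroup (absoluteGaloisGroup K)} (h : H ≤ H') (hH : IsOpen (H : Set (absoluteGaloisGroup K)))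
    [Fintype (H' ⧸ H.subgroupOf H')] (L : ℕ) (y : W.torsionH1Over ((p : ℤ) ^ L) H') {n : ℕ} (hidx : (H.subgroupOf H').index = n) :
    coresLe (W.torsionGaloisModule ((p : ℤ) ^ L)).toTopRep h hH (resLe (W.torsionGaloisModule ((p : ℤ) ^ L)).toTopRep h 1 y) =
      n • y := by
  rw [coresLe_resLe_eq_index_smul (W.torsionGaloisModule ((p : ℤ) ^ L)).toTopRep h hH, hidx, Nat.cast_smul_eq_nsmul]
  rfl

omit [W.IsElliptic] hp in
/-- **Tail of the schedule (pure bookkeeping).** If `push (ι_* A) = push ((m·n) • y♭)` and `push (n • y♭) = push y_j`, then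
`push (A − m • y_j) = 0`. [folklore] -/
theorem push_sub_eq_zero_of_pushes (H : Subgroup (absoluteGaloisGroup K)) {L L' : ℕ}
    (ι : (W.torsionGaloisModule ((p : ℤ) ^ L)).toTopRep ⟶ (W.torsionGaloisModule ((p : ℤ) ^ L')).toTopRep)
    (hι : ∀ P : W.geomTorsion ((p : ℤ) ^ L), ((ι.hom P : W.geomTorsion ((p : ℤ) ^ L')) : W.geomPoints) = (P : W.geomPoints))
    (A yj : W.torsionH1Over ((p : ℤ) ^ L) H) (yflat : W.torsionH1Over ((p : ℤ) ^ L') H) (m n : ℕ)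
    (h1 : resH1Hom (N := W.geomPrimaryTorsion p) (subgroupInclusion (le_refl H))
        (AddSubgroup.inclusion (AcSigned.geomTorsion_zpow_le_geomPrimaryTorsion W p L')) (fun _ _ ↦ rfl)
        (cohomologyMap (subgroupRepHom ι H) 1 A) =
      resH1Hom (N := W.geomPrimaryTorsion p) (subgroupInclusion (le_refl H))
        (AddSubgroup.inclusion (AcSigned.geomTorsion_zpow_le_geomPrimaryTorsion W p L')) (fun _ _ ↦ rfl) ((m * n) • yflat))
    (h2 : resH1Hom (N := W.geomPrimaryTorsion p) (subgroupInclusion (le_refl H))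
        (AddSubgroup.inclusion (AcSigned.geomTorsion_zpow_le_geomPrimaryTorsion W p L')) (fun _ _ ↦ rfl) (n • yflat) =
      resH1Hom (N := W.geomPrimaryTorsion p) (subgroupInclusion (le_refl H))
        (AddSubgroup.inclusion (AcSigned.geomTorsion_zpow_le_geomPrimaryTorsion W p L)) (fun _ _ ↦ rfl) yj) :
    resH1Hom (N := W.geomPrimaryTorsion p) (subgroupInclusion (le_refl H))
        (AddSubgroup.inclusion (AcSigned.geomTorsion_zpow_le_geomPrimaryTorsion W p L)) (fun _ _ ↦ rfl) (A - m • yj) = 0 := by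
  rw [push_sub, sub_eq_zero, ← push_cohomologyMap_incl W p H ι hι A, h1, mul_nsmul', push_nsmul, h2, ← push_nsmul]

omit [W.IsElliptic] in
/-- **A class of `H¹(Γ_K, E[p^L])` whose image in `H¹(Γ_K, E[p^∞])` vanishes is killed by the exponent of
`B = E(K_∞)[p^∞]`**: such a class is `∂Q` with `Q ∈ E[p^∞]`, `p^L Q` is `Γ_K`-fixed (so lies in `B`), and if `p^{e'} · B = 0` then
`p^{e'} Q ∈ E[p^L]`, so `p^{e'}` times the class is a coboundary. [cite: SerreGaloisCohomology1997, I §5.1] -/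
theorem pow_nsmul_eq_zero_of_cohomologyMap_primary_eq_zero (κ : ZpExtension K p) {e' : ℕ}
    (he' : ∀ P : W.geomPrimaryTorsion p, P ∈ FixedPoints.addSubgroup κ.kerSubgroup (W.geomPrimaryTorsion p) → p ^ e' • P = 0)
    (L : ℕ) (ι : (W.torsionGaloisModule ((p : ℤ) ^ L)).toTopRep ⟶ discreteTopRep (absoluteGaloisGroup K) (W.geomPrimaryTorsion p))
    (hι : ∀ P : W.geomTorsion ((p : ℤ) ^ L), ((ι.hom P : W.geomPrimaryTorsion p) : W.geomPoints) = (P : W.geomPoints))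
    (u : continuousCohomology 1 (W.torsionGaloisModule ((p : ℤ) ^ L)).toTopRep) (hu : cohomologyMap ι 1 u = 0) :
    p ^ e' • u = 0 := by
  obtain ⟨φ, rfl⟩ := oneCocycleClass_surjective (W.torsionGaloisModule ((p : ℤ) ^ L)).toTopRep u
  rw [cohomologyMap_oneCocycleClass, oneCocycleClass_eq_zero_iff] at hu
  obtain ⟨Q, hQ⟩ := hu
  have hQ' : ∀ σ : absoluteGaloisGroup K, ι.hom (φ.1 σ) = σ • Q - Q := fun σ ↦ by
    have h := hQ σ; rwa [pullback_id_resIdHom_apply] at h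
  -- `p^L • Q ∈ B`
  have ht : p ^ L • Q ∈ FixedPoints.addSubgroup κ.kerSubgroup (W.geomPrimaryTorsion p) := by
    refine (mem_fixedPoints_kerSubgroup_iff W p κ _).2 fun τ _ ↦ ?_
    rw [← sub_eq_zero, smul_comm, ← nsmul_sub, ← hQ' τ, ← map_nsmul]
    have h0 : p ^ L • φ.1 τ = 0 := Subtype.ext (by
      rw [AddSubgroupClass.coe_nsmul, ZeroMemClass.coe_zero, ← natCast_zsmul, Nat.cast_pow]
      exact (mem_geomTorsion_iff W _ _).mp (φ.1 τ).2)
    rw [h0, map_zero]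
  have hkill : p ^ e' • (p ^ L • Q) = 0 := he' _ ht
  have hx : ((p ^ e' • Q : W.geomPrimaryTorsion p) : W.geomPoints) ∈ W.geomTorsion ((p : ℤ) ^ L) := by
    rw [mem_geomTorsion_iff, ← Nat.cast_pow, natCast_zsmul, ← AddSubgroupClass.coe_nsmul, smul_comm, hkill, ZeroMemClass.coe_zero]
  rw [← Nat.cast_smul_eq_nsmul ℤ, ← oneCocycleClass_smul, oneCocycleClass_eq_zero_iff]
  refine ⟨⟨_, hx⟩, fun σ ↦ Subtype.ext ?_⟩
  have hval := congrArg (fun P : W.geomPrimaryTorsion p ↦ ((p ^ e' • P : W.geomPrimaryTorsion p) : W.geomPoints)) (hQ' σ)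
  simp only [hι, AddSubgroupClass.coe_sub, nsmul_sub,
    Literature.NumberTheory.EllipticCurves.primaryComponent.coe_smul] at hval
  change (((((p ^ e' : ℕ) : ℤ) • φ).1 σ : W.geomTorsion ((p : ℤ) ^ L)) : W.geomPoints) =
    (((σ • (⟨_, hx⟩ : W.geomTorsion ((p : ℤ) ^ L)) - ⟨_, hx⟩ : W.geomTorsion ((p : ℤ) ^ L))) : W.geomPoints)
  rw [AddSubgroupClass.coe_sub, Literature.NumberTheory.EllipticCurves.AddSubgroup.torsionBy.coe_smul]
  change ((((p ^ e' : ℕ) : ℤ) • (φ.1 σ : W.geomTorsion ((p : ℤ) ^ L)) : W.geomTorsion ((p : ℤ) ^ L)) : W.geomPoints) =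
    σ • ((p ^ e' • Q : W.geomPrimaryTorsion p) : W.geomPoints) - ((p ^ e' • Q : W.geomPrimaryTorsion p) : W.geomPoints)
  rw [AddSubgroupClass.coe_zsmul, natCast_zsmul, hval, AddSubgroupClass.coe_nsmul, smul_comm]

omit [W.IsElliptic] hp in
/-- The restriction `H¹(Γ_K, E[p^∞]) → H¹(S, E[p^∞])` of the `resH1Hom` dialect is `resSubgroup` of the `discreteTopRep`. [folklore] -/
theorem resH1Hom_subgroupIncl_eq_resSubgroup (S : Subgroup (absoluteGaloisGroup K))
    (z : discreteH1 (absoluteGaloisGroup K) (W.geomPrimaryTorsion p)) :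
    resH1Hom (Literature.NumberTheory.EllipticCurves.subgroupIncl S) (AddMonoidHom.id (W.geomPrimaryTorsion p)) (fun _ _ ↦ rfl) z =
      resSubgroup (discreteTopRep (absoluteGaloisGroup K) (W.geomPrimaryTorsion p)) S 1 z := by
  obtain ⟨φ, rfl⟩ := oneCocycleClass_surjective (discreteTopRep (absoluteGaloisGroup K) (W.geomPrimaryTorsion p)) z
  refine (resH1Hom_oneCocycleClass _ _ _ φ).trans (Eq.trans ?_ (resSubgroup_oneCocycleClass _ S φ).symm)
  exact congrArg _ (Subtype.ext (ContinuousMap.ext fun _ ↦ rfl))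

omit [W.IsElliptic] hp in
/-- `conjMap` of the `discreteTopRep` of `E[p^∞]` is the tree's `conjH1` (definitional). [folklore] -/
theorem conjMap_primary_eq_conjH1 (H : Subgroup (absoluteGaloisGroup K)) [H.Normal] (σ : absoluteGaloisGroup K)
    (y : W.subgroupH1 p H) :
    conjMap (discreteTopRep (absoluteGaloisGroup K) (W.geomPrimaryTorsion p)) H σ 1 y = W.conjH1 p H σ y := rfl

omit [W.IsElliptic] hp in
/-- Restricting to a layer and then to a smaller subgroup is restricting directly (both `resH1Hom` restrictions of one class of
`Γ_K`). [folklore] -/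
theorem resOfLe_resH1Hom_subgroupIncl {S S' : Subgroup (absoluteGaloisGroup K)} (h : S' ≤ S)
    (z : discreteH1 (absoluteGaloisGroup K) (W.geomPrimaryTorsion p)) :
    W.resOfLe p h (resH1Hom (Literature.NumberTheory.EllipticCurves.subgroupIncl S) (AddMonoidHom.id (W.geomPrimaryTorsion p))
      (fun _ _ ↦ rfl) z) =
      resH1Hom (Literature.NumberTheory.EllipticCurves.subgroupIncl S') (AddMonoidHom.id (W.geomPrimaryTorsion p)) (fun _ _ ↦ rfl) z := by
  simp only [WeierstrassCurve.resOfLe, Literature.NumberTheory.EllipticCurves.resOfLe, resH1Hom_resH1Hom]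
  exact DFunLike.congr_fun (resH1Hom_congr (by ext; rfl) (by ext; rfl) _ _) _

end Bridges


/-! ## §2 A uniform power of `p` kills `cor_{Γ_n → Γ_ℚ}` of every Selmer class of every layer -/

section SelmerKill

variable (W : WeierstrassCurve ℚ) [W.IsElliptic] [W.IsGloballyMinimal] (p : ℕ) [hp : Fact p.Prime] (κ : ZpExtension ℚ p)
  (hκ : κ.IsCyclotomic) (hord : IsOrdinaryAt W p)

include hκ hord in
/-- **`p^{e₂} · cor_{Γ_n→Γ_ℚ} Y = 0` for every `Y ∈ Sel_{p^∞}(E/ℚ_n)`, uniformly in `n`.** The restriction of `cor Y` to `Γ_∞` is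
the NORM `Σ_{x ∈ Γ/Γ_n} conj_{s(x)} (h_n Y)` (`resSubgroup_cores_eq_sum`), which lies in `Sel_{p^∞}(E/ℚ_∞)^Γ` — a FINITE group
under «good ordinary at `p`, `Sel_{p^∞}(E/ℚ)` finite» (Mazur control, `finite_selmerInfty_inf_layerInvariants_zero`) — so a multiple
`M₀ · cor Y` dies over `ℚ_∞`, hence is killed by the exponent `p^e` of `E(ℚ_∞)[p^∞]` (brick `…B6Principal` §2).
[cite: GreenbergLNM1716, Thm. 1.2 (pp. 59–60), §3 Lemma 3.1 (p. 86), §4 Lemma 4.6 (p. 105)] -/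
theorem exists_pow_nsmul_cores_eq_zero_of_mem_selmerLayer [Finite (W.selmerGroupPInfty p)] :
    ∃ e₂ : ℕ, ∀ (n : ℕ) [Fintype (absoluteGaloisGroup ℚ ⧸ κ.layerSubgroup n)] (Y : W.subgroupH1 p (κ.layerSubgroup n)),
      Y ∈ W.selmerLayer κ n →
      p ^ e₂ • cores (discreteTopRep (absoluteGaloisGroup ℚ) (W.geomPrimaryTorsion p)) (κ.layerSubgroup n)
        (κ.isOpen_layerSubgroup n) Y = 0 := by
  have hfin : Finite (W.selmerGroupPInfty p) := ‹_›
  have hp' : ∀ v : HeightOneSpectrum (𝓞 ℚ), (p : 𝓞 ℚ) ∈ v.asIdeal → W.HasGoodReductionAt v ∧ W.HasUnitRootAt v :=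
    fun v hv ↦ W.hasGoodReductionAt_and_hasUnitRootAt_of_rat hord.1 hord.2 v hv
  obtain ⟨Bc, hBc⟩ := GoodOrdTower.selmer_control_all W κ hκ hp'
  have hF : Finite ↥(W.selmerInfty κ ⊓ W.layerInvariants κ 0) :=
    W.finite_selmerInfty_inf_layerInvariants_zero κ hfin (hBc 0).2.2.1
  obtain ⟨e, he⟩ := exists_pow_nsmul_eq_zero_of_resOfLe_kerSubgroup_eq_zero W p κ
  refine ⟨padicValNat p (Nat.card ↥(W.selmerInfty κ ⊓ W.layerInvariants κ 0) * p ^ e), fun n _ Y hY ↦ ?_⟩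
  haveI : CompactSpace (absoluteGaloisGroup ℚ) := absoluteGaloisGroup_compactSpace ℚ
  -- `cor Y` is `p`-power torsion
  obtain ⟨φz, hφz⟩ := oneCocycleClass_surjective (discreteTopRep (absoluteGaloisGroup ℚ) (W.geomPrimaryTorsion p))
    (cores (discreteTopRep (absoluteGaloisGroup ℚ) (W.geomPrimaryTorsion p)) (κ.layerSubgroup n) (κ.isOpen_layerSubgroup n) Y)
  obtain ⟨k, hzk⟩ := IwasawaDual.exists_pow_smul_oneCocycleClass_eq_zero (p := p) φz fun σ ↦ by
    obtain ⟨k, hk⟩ := (φz.1 σ).2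
    exact ⟨k, Subtype.ext (by rw [AddSubgroupClass.coe_nsmul, hk, ZeroMemClass.coe_zero])⟩
  rw [hφz] at hzk
  refine TorsionEulerChar.H46LevelZero.pow_padicValNat_nsmul_eq_zero p
    (mul_ne_zero Nat.card_pos.ne' (pow_ne_zero _ hp.out.ne_zero)) ?_ hzk
  -- the restriction of `cor Y` to `Γ_n` is the norm; its restriction to `Γ_∞` through the layer `0`
  have hsum : resH1Hom (Literature.NumberTheory.EllipticCurves.subgroupIncl (κ.layerSubgroup n))
      (AddMonoidHom.id (W.geomPrimaryTorsion p)) (fun _ _ ↦ rfl)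
      (cores (discreteTopRep (absoluteGaloisGroup ℚ) (W.geomPrimaryTorsion p)) (κ.layerSubgroup n) (κ.isOpen_layerSubgroup n) Y) =
      ∑ x : absoluteGaloisGroup ℚ ⧸ κ.layerSubgroup n, W.conjH1 p (κ.layerSubgroup n) (Quotient.out x) Y := by
    rw [resH1Hom_subgroupIncl_eq_resSubgroup]
    have h := resSubgroup_cores_eq_sum (discreteTopRep (absoluteGaloisGroup ℚ) (W.geomPrimaryTorsion p)) (κ.layerSubgroup n)
      (κ.isOpen_layerSubgroup n) QuotientGroup.out_eq' Y
    rw [h]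
    exact Finset.sum_congr rfl fun x _ ↦ conjMap_primary_eq_conjH1 W p _ _ _
  have hres : W.layerToInfty κ 0 (resH1Hom (Literature.NumberTheory.EllipticCurves.subgroupIncl (κ.layerSubgroup 0))
      (AddMonoidHom.id (W.geomPrimaryTorsion p)) (fun _ _ ↦ rfl)
      (cores (discreteTopRep (absoluteGaloisGroup ℚ) (W.geomPrimaryTorsion p)) (κ.layerSubgroup n) (κ.isOpen_layerSubgroup n) Y)) =
      W.layerToInfty κ n (resH1Hom (Literature.NumberTheory.EllipticCurves.subgroupIncl (κ.layerSubgroup n))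
      (AddMonoidHom.id (W.geomPrimaryTorsion p)) (fun _ _ ↦ rfl)
      (cores (discreteTopRep (absoluteGaloisGroup ℚ) (W.geomPrimaryTorsion p)) (κ.layerSubgroup n) (κ.isOpen_layerSubgroup n) Y)) := by
    rw [WeierstrassCurve.layerToInfty, WeierstrassCurve.layerToInfty, resOfLe_resH1Hom_subgroupIncl, resOfLe_resH1Hom_subgroupIncl]
  have hmemA : W.layerToInfty κ 0 (resH1Hom (Literature.NumberTheory.EllipticCurves.subgroupIncl (κ.layerSubgroup 0))
      (AddMonoidHom.id (W.geomPrimaryTorsion p)) (fun _ _ ↦ rfl)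
      (cores (discreteTopRep (absoluteGaloisGroup ℚ) (W.geomPrimaryTorsion p)) (κ.layerSubgroup n) (κ.isOpen_layerSubgroup n) Y)) ∈
      W.selmerInfty κ := by
    rw [hres, hsum, map_sum]
    refine AddSubgroup.sum_mem _ fun x _ ↦ ?_
    rw [W.layerToInfty_conjH1 κ]
    exact W.map_conjH1_selmerGroupOver_le_holds p κ.kerSubgroup _
      ⟨_, W.map_layerToInfty_selmerLayer_le_holds κ n ⟨Y, hY, rfl⟩, rfl⟩
  have hmemI : W.layerToInfty κ 0 (resH1Hom (Literature.NumberTheory.EllipticCurves.subgroupIncl (κ.layerSubgroup 0))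
      (AddMonoidHom.id (W.geomPrimaryTorsion p)) (fun _ _ ↦ rfl)
      (cores (discreteTopRep (absoluteGaloisGroup ℚ) (W.geomPrimaryTorsion p)) (κ.layerSubgroup n) (κ.isOpen_layerSubgroup n) Y)) ∈
      W.layerInvariants κ 0 := W.range_layerToInfty_le_layerInvariants_holds κ 0 ⟨_, rfl⟩
  have hM₀ : Nat.card ↥(W.selmerInfty κ ⊓ W.layerInvariants κ 0) •
      W.layerToInfty κ 0 (resH1Hom (Literature.NumberTheory.EllipticCurves.subgroupIncl (κ.layerSubgroup 0))
      (AddMonoidHom.id (W.geomPrimaryTorsion p)) (fun _ _ ↦ rfl)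
      (cores (discreteTopRep (absoluteGaloisGroup ℚ) (W.geomPrimaryTorsion p)) (κ.layerSubgroup n) (κ.isOpen_layerSubgroup n) Y)) = 0 := by
    have h := addOrderOf_dvd_natCard (G := ↥(W.selmerInfty κ ⊓ W.layerInvariants κ 0)) ⟨_, AddSubgroup.mem_inf.mpr ⟨hmemA, hmemI⟩⟩
    have h' := addOrderOf_dvd_iff_nsmul_eq_zero.mp h
    rwa [Subtype.ext_iff, AddSubgroupClass.coe_nsmul, ZeroMemClass.coe_zero] at h'
  have hkill : p ^ e • (Nat.card ↥(W.selmerInfty κ ⊓ W.layerInvariants κ 0) •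
      resH1Hom (Literature.NumberTheory.EllipticCurves.subgroupIncl (κ.layerSubgroup 0))
        (AddMonoidHom.id (W.geomPrimaryTorsion p)) (fun _ _ ↦ rfl)
        (cores (discreteTopRep (absoluteGaloisGroup ℚ) (W.geomPrimaryTorsion p)) (κ.layerSubgroup n) (κ.isOpen_layerSubgroup n) Y)) = 0 :=
    he (κ.kerSubgroup_le_layerSubgroup 0) _ (by rw [map_nsmul]; exact hM₀)
  -- transfer to `cor Y` along the bijective restriction to `Γ_0`
  have hbij := bijective_resH1Hom_subgroupIncl (W.geomPrimaryTorsion p) (κ.layerSubgroup 0)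
    (TorsionEulerChar.H46LevelZero.mem_layerSubgroup_zero p κ)
  apply hbij.1
  rw [map_nsmul, map_zero, mul_nsmul']
  exact (smul_comm _ _ _).trans hkill

end SelmerKill

end TorsionEulerChar.B6

end Summit.BirchSwinnertonDyer.BirchSwinnertonDyer.Theorems

end
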